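import Mathlib
import Literature.NumberTheory.LFunctions.Zhang2022.Section11LamCSums
import HarnessLib

/-!
# Zhang (2022) §§7, 11, 12: short sums of the `λ₀ⱼ`-majorant `Λc` and the convergent `r`-weights
# of `S_j` — the `c`-input of the window engine

Topic `Literature/NumberTheory/LFunctions/Zhang2022` (Landau–Siegel audit tree; verdict-neutral).
Y. Zhang, *Discrete mean estimates and the Landau–Siegel zero*, arXiv:2211.02515v1 (2022)
[Zhang2022LandauSiegel], §7 p. 33 (Prop. 7.1: the weights `|μ(r)|λ₀ⱼ(dr)/(drφ(r))` of
`S_j(𝐚₁,𝐚₂)`), §11 p. 64 / §12 p. 67 ("(8.25), (8.26) and simple estimates") — **an unrefereed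
manuscript under adjudication; nothing here asserts or denies its Theorems 1–2** (ZHANG-L
discharge lane, WP11/WP12).

The window engine `Section12SjWindowEngine.window_triple_sum_le` needs, for the weight
`c(k) = Σ_{dr=k} Λc(d)·Λc(r)2^{ω(r)}/φ(r)`, the SHORT-SUM bound `Σ_{y<k≤y+h} c(k) ≤ A'(h + √(y+h))`.
This file supplies its two ingredients:

* `sum_LamC_short_le` — **`Σ_{u<d≤u+v} Λc(d) ≤ E₀v + E₁√(u+v)`** (`Λc = ζ ∗ h`, `h` the squarefree
  kernel `μ²(k)∏_{p∣k}12/p` of `Section11LamCSums`; multiples of `e` in `(u,u+v]` number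
  `≤ v/e + 1`; `Σ_e h(e)/e ≤ E₀` is the tree's `sum_sqfreeKernel_div_le`, and `Σ_{e≤Z} h(e) ≤ E₁√Z`
  by the Euler product `∏_p(1 + 12p^{−3/2})`);
* `sum_rho_div_sqrt_le` — **`Σ_{r≤X} Λc(r)2^{ω(r)}/(φ(r)√r) ≤ e^{112}`** (Euler product
  `∏_p(1 + 56p^{−3/2})`), with the elementary `Σ_{p≤X} 1/(p√p) ≤ 2`.

No statement about the manuscript's Theorems 1–2 or about Landau–Siegel zeros is made or implied.

## References

* Y. Zhang, arXiv:2211.02515v1 (2022), §7 Prop. 7.1 p. 33; §11 p. 64; §12 p. 67.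
  [cite: Zhang2022LandauSiegel, §7 Prop. 7.1 p.33; §12 p.67]
* R. R. Hall, G. Tenenbaum, *Divisors* (CUP 1988), (0.4). [cite: HallTenenbaum1988, (0.4)]
-/

noncomputable section

open Finset Real ArithmeticFunction

namespace Literature.NumberTheory.LFunctions.Zhang2022.XiZeroMajorant

/-! ### Part 1. `Σ_{n≥2} 1/(n√n) ≤ 2` and an Euler product with `p^{−3/2}` decay -/

/-- `Σ_{2≤n≤X} 1/(n√n) ≤ 2` (telescoping `1/(n√n) ≤ 2(1/√(n−1) − 1/√n)`). [folklore] -/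
private theorem sum_inv_mul_sqrt_le (X : ℕ) :
    ∑ n ∈ Icc 2 X, (1 : ℝ) / ((n : ℝ) * Real.sqrt n) ≤ 2 := by
  -- telescoping bound: partial sums ≤ 2 − 2/√X
  suffices h : ∀ X : ℕ, 1 ≤ X →
      ∑ n ∈ Icc 2 X, (1 : ℝ) / ((n : ℝ) * Real.sqrt n) ≤ 2 - 2 / Real.sqrt X by
    rcases Nat.eq_zero_or_pos X with rfl | hX
    · simp
    · exact (h X hX).trans (by
        have : 0 ≤ 2 / Real.sqrt X := by positivity
        linarith)
  intro X hX
  induction X with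
  | zero => omega
  | succ X ih =>
    rcases Nat.eq_zero_or_pos X with rfl | hX0
    · simp
    · rw [Finset.sum_Icc_succ_top (by omega), Nat.cast_succ]
      have ih' := ih hX0
      have hX1 : (1 : ℝ) ≤ X := by exact_mod_cast hX0
      have hs0 : 0 < Real.sqrt (X : ℝ) := Real.sqrt_pos.mpr (by linarith)
      have hs1 : 0 < Real.sqrt ((X : ℝ) + 1) := Real.sqrt_pos.mpr (by linarith)
      -- `1/((X+1)√(X+1)) ≤ 2/√X − 2/√(X+1)`: with `a = √X`, `b = √(X+1)`, `b − a = 1/(a+b)`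
      have hkey : 1 / (((X : ℝ) + 1) * Real.sqrt ((X : ℝ) + 1)) ≤
          2 / Real.sqrt X - 2 / Real.sqrt ((X : ℝ) + 1) := by
        set a := Real.sqrt (X : ℝ) with ha
        set b := Real.sqrt ((X : ℝ) + 1) with hb
        have hsq0 : a ^ 2 = X := Real.sq_sqrt (by linarith)
        have hsq1 : b ^ 2 = (X : ℝ) + 1 := Real.sq_sqrt (by linarith)
        have hle : a ≤ b := Real.sqrt_le_sqrt (by linarith)
        have hab : 0 < a + b := by linarith
        have hba : b - a = 1 / (a + b) := by
          field_simp
          nlinarith [hsq0, hsq1]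
        have e2 : 2 / a - 2 / b = 2 * (b - a) / (a * b) := by
          field_simp
        rw [e2, hba, ← hsq1]
        rw [div_le_div_iff₀ (by positivity) (by positivity)]
        have e3 : 2 * (1 / (a + b)) * (b ^ 2 * b) = 2 * b ^ 3 / (a + b) := by
          field_simp
        rw [e3, le_div_iff₀ hab, one_mul]
        nlinarith [mul_le_mul_of_nonneg_left hle hs0.le, mul_le_mul_of_nonneg_left hle hs1.le,
          mul_pos hs0 hs1]
      linarith


/-- `Σ_{p ≤ X prime} 1/(p√p) ≤ 2`. [folklore] -/
private theorem sum_primes_inv_mul_sqrt_le (X : ℕ) :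
    ∑ p ∈ Nat.primesLE X, (1 : ℝ) / ((p : ℝ) * Real.sqrt p) ≤ 2 := by
  have hsub : Nat.primesLE X ⊆ Icc 2 X := by
    intro p hp
    rw [Nat.mem_primesLE] at hp
    exact mem_Icc.mpr ⟨hp.2.two_le, hp.1⟩
  exact (sum_le_sum_of_subset_of_nonneg hsub fun p _ _ => by positivity).trans
    (sum_inv_mul_sqrt_le X)

/-- **An Euler product with `p^{−3/2}` decay.** Let `f ≥ 0` be multiplicative on coprime
arguments with `f(1) = 1` and `f(p^ν)/p^ν ≤ (c/(p√p))·2^{1−ν}` for `ν ≥ 1` (`c ≥ 0`). Then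
`Σ_{n≤X} f(n)/n ≤ e^{4c}` for every `X` (Hall–Tenenbaum (0.4): `≤ ∏_{p≤X}(1 + 2c/(p√p))
≤ exp(2c·Σ_p 1/(p√p)) ≤ e^{4c}`). [cite: HallTenenbaum1988, (0.4)] -/
theorem sum_div_le_exp_of_decay {f : ℕ → ℝ} (hf1 : f 1 = 1)
    (hmul : ∀ m n, Nat.Coprime m n → f (m * n) = f m * f n) (hf0 : ∀ n, 0 ≤ f n) {c : ℝ}
    (hc : 0 ≤ c)
    (hdec : ∀ p ν : ℕ, p.Prime → 1 ≤ ν →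
      f (p ^ ν) / (p : ℝ) ^ ν ≤ c / ((p : ℝ) * Real.sqrt p) * (1 / 2 : ℝ) ^ (ν - 1)) (X : ℕ) :
    ∑ n ∈ Icc 1 X, f n / n ≤ Real.exp (4 * c) := by
  -- local bound by a geometric series
  have hb : ∀ p : ℕ, p.Prime → ∀ ν : ℕ, f (p ^ ν) / (p : ℝ) ^ ν ≤
      (1 + 2 * c / ((p : ℝ) * Real.sqrt p)) * (1 / 2 : ℝ) ^ ν := by
    intro p hp ν
    have hp0 : (0 : ℝ) < p := by exact_mod_cast hp.pos
    have hcp : 0 ≤ 2 * c / ((p : ℝ) * Real.sqrt p) := by positivity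
    rcases Nat.eq_zero_or_pos ν with rfl | hν
    · simp [hf1]; linarith
    · refine (hdec p ν hp hν).trans ?_
      have e : c / ((p : ℝ) * Real.sqrt p) * (1 / 2 : ℝ) ^ (ν - 1) =
          2 * c / ((p : ℝ) * Real.sqrt p) * (1 / 2 : ℝ) ^ ν := by
        obtain ⟨k, rfl⟩ : ∃ k, ν = k + 1 := ⟨ν - 1, by omega⟩
        rw [Nat.add_sub_cancel, pow_succ]; ring
      rw [e]
      exact mul_le_mul_of_nonneg_right (by linarith) (by positivity)
  have hsum : ∀ p : ℕ, p.Prime → Summable (fun ν : ℕ => f (p ^ ν) / (p : ℝ) ^ ν) := by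
    intro p hp
    exact Summable.of_nonneg_of_le (fun ν => div_nonneg (hf0 _) (by positivity)) (hb p hp)
      ((summable_geometric_of_lt_one (by norm_num) (by norm_num)).mul_left _)
  -- local factor ≤ 1 + 2c/(p√p)
  have hloc : ∀ p : ℕ, p.Prime →
      ∑' ν : ℕ, f (p ^ ν) / (p : ℝ) ^ ν ≤ 1 + 2 * c / ((p : ℝ) * Real.sqrt p) := by
    intro p hp
    have hcp : 0 ≤ 2 * c / ((p : ℝ) * Real.sqrt p) := by
      have hp0 : (0 : ℝ) < p := by exact_mod_cast hp.pos
      positivity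
    have hsplit := (hsum p hp).sum_add_tsum_nat_add 1
    have h1 : ∑ i ∈ range 1, f (p ^ i) / (p : ℝ) ^ i = 1 := by simp [hf1]
    rw [← hsplit, h1]
    have htail : ∑' i : ℕ, f (p ^ (i + 1)) / (p : ℝ) ^ (i + 1) ≤
        ∑' i : ℕ, c / ((p : ℝ) * Real.sqrt p) * (1 / 2 : ℝ) ^ i := by
      refine Summable.tsum_le_tsum (fun i => ?_) ((summable_nat_add_iff 1).mpr (hsum p hp)) ?_
      · have h := hdec p (i + 1) hp (by omega)
        rw [Nat.add_sub_cancel] at h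
        exact h
      · exact (summable_geometric_of_lt_one (by norm_num) (by norm_num)).mul_left _
    have hgeo : ∑' i : ℕ, c / ((p : ℝ) * Real.sqrt p) * (1 / 2 : ℝ) ^ i =
        2 * c / ((p : ℝ) * Real.sqrt p) := by
      rw [tsum_mul_left, tsum_geometric_of_lt_one (by norm_num) (by norm_num)]
      ring
    linarith
  have hprod : ∏ p ∈ Nat.primesLE X, ∑' ν : ℕ, f (p ^ ν) / (p : ℝ) ^ ν ≤
      Real.exp (∑ p ∈ Nat.primesLE X, 2 * c / ((p : ℝ) * Real.sqrt p)) := by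
    rw [Real.exp_sum]
    refine prod_le_prod (fun p _ => tsum_nonneg fun ν => div_nonneg (hf0 _) (by positivity))
      fun p hp => (hloc p (Nat.mem_primesLE.1 hp).2).trans ?_
    have h := Real.add_one_le_exp (2 * c / ((p : ℝ) * Real.sqrt p))
    linarith
  have hexp : ∑ p ∈ Nat.primesLE X, 2 * c / ((p : ℝ) * Real.sqrt p) ≤ 4 * c := by
    have e : ∑ p ∈ Nat.primesLE X, 2 * c / ((p : ℝ) * Real.sqrt p) =
        2 * c * ∑ p ∈ Nat.primesLE X, 1 / ((p : ℝ) * Real.sqrt p) := by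
      rw [mul_sum]; exact sum_congr rfl fun p _ => by ring
    rw [e]
    nlinarith [sum_primes_inv_mul_sqrt_le X]
  calc ∑ n ∈ Icc 1 X, f n / n ≤ ∏ p ∈ Nat.primesLE X, ∑' ν : ℕ, f (p ^ ν) / (p : ℝ) ^ ν :=
        HallTenenbaum.sum_div_le_prod_tsum hf1 hmul hf0 hsum X
    _ ≤ Real.exp (∑ p ∈ Nat.primesLE X, 2 * c / ((p : ℝ) * Real.sqrt p)) := hprod
    _ ≤ Real.exp (4 * c) := Real.exp_le_exp.mpr hexp

/-! ### Part 2. The squarefree kernel `h` of `Λc`: `Σ_{e≤X} h(e) ≤ e^{48}√X` -/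

/-- **`Σ_{e≤X} h(e) ≤ e^{48}√X`** for the squarefree kernel `h(e) = μ²(e)∏_{p∣e}12/p` of `Λc`
(`h(e) = (h(e)√e)/√e ≤ √X·(h(e)√e)/e` and `e ↦ h(e)√e` has prime value `12/√p`, so its
logarithmic mean is `≤ ∏_p(1+24/(p√p)) ≤ e^{48}`). [cite: Zhang2022LandauSiegel, §7 p.33] -/
theorem sum_sqfreeKernel_le_sqrt (X : ℕ) :
    ∑ e ∈ Icc 1 X, (if Squarefree e then ∏ p ∈ e.primeFactors, 12 / (p : ℝ) else 0) ≤
      Real.exp 48 * Real.sqrt X := by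
  set f : ℕ → ℝ := fun e =>
    (if Squarefree e then ∏ p ∈ e.primeFactors, 12 / (p : ℝ) else 0) * Real.sqrt e with hf
  have hf0 : ∀ e, 0 ≤ f e := fun e => mul_nonneg (sqfreeKernel_nonneg e) (Real.sqrt_nonneg _)
  have hf1 : f 1 = 1 := by simp [hf]
  have hmul : ∀ m n, Nat.Coprime m n → f (m * n) = f m * f n := by
    intro m n hmn
    rcases Nat.eq_zero_or_pos m with rfl | hm
    · simp only [Nat.coprime_zero_left] at hmn; subst hmn; simp [hf]
    rcases Nat.eq_zero_or_pos n with rfl | hn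
    · simp only [Nat.coprime_zero_right] at hmn; subst hmn; simp [hf]
    simp only [hf]
    rw [sqfreeKernel_mul_of_coprime hm.ne' hn.ne' hmn, Nat.cast_mul,
      Real.sqrt_mul (Nat.cast_nonneg m)]
    ring
  have hdec : ∀ p ν : ℕ, p.Prime → 1 ≤ ν →
      f (p ^ ν) / (p : ℝ) ^ ν ≤ 12 / ((p : ℝ) * Real.sqrt p) * (1 / 2 : ℝ) ^ (ν - 1) := by
    intro p ν hp hν
    have hp0 : (0 : ℝ) < p := by exact_mod_cast hp.pos
    simp only [hf]
    rw [sqfreeKernel_prime_pow hp ν, if_neg (by omega)]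
    rcases eq_or_ne ν 1 with rfl | hν1
    · rw [if_pos rfl, zero_add, pow_one, pow_one, Nat.sub_self, pow_zero, mul_one]
      have hsp : 0 < Real.sqrt (p : ℝ) := Real.sqrt_pos.mpr hp0
      set t := Real.sqrt (p : ℝ) with ht
      have hsq : t * t = p := Real.mul_self_sqrt hp0.le
      rw [← hsq]
      apply le_of_eq
      field_simp
    · rw [if_neg hν1, add_zero, zero_mul, zero_div]
      positivity
  have hmean := sum_div_le_exp_of_decay hf1 hmul hf0 (by norm_num : (0 : ℝ) ≤ 12) hdec X
  have hpt : ∀ e ∈ Icc 1 X, (if Squarefree e then ∏ p ∈ e.primeFactors, 12 / (p : ℝ) else 0) ≤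
      Real.sqrt X * (f e / e) := by
    intro e he
    have he1 : (1 : ℝ) ≤ e := by exact_mod_cast (mem_Icc.mp he).1
    have heX : (e : ℝ) ≤ X := by exact_mod_cast (mem_Icc.mp he).2
    have he0 : (0 : ℝ) < e := by linarith
    have hse : 0 < Real.sqrt (e : ℝ) := Real.sqrt_pos.mpr he0
    have hk0 := sqfreeKernel_nonneg e
    -- `h(e) ≤ √X·h(e)√e/e` iff `e ≤ √X√e` iff `√e ≤ √X`
    have hkey : (1 : ℝ) ≤ Real.sqrt X * Real.sqrt e / e := by
      rw [le_div_iff₀ he0, one_mul]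
      calc (e : ℝ) = Real.sqrt e * Real.sqrt e := (Real.mul_self_sqrt he0.le).symm
        _ ≤ Real.sqrt X * Real.sqrt e :=
            mul_le_mul_of_nonneg_right (Real.sqrt_le_sqrt heX) hse.le
    calc (if Squarefree e then ∏ p ∈ e.primeFactors, 12 / (p : ℝ) else 0)
        = (if Squarefree e then ∏ p ∈ e.primeFactors, 12 / (p : ℝ) else 0) * 1 := (mul_one _).symm
      _ ≤ (if Squarefree e then ∏ p ∈ e.primeFactors, 12 / (p : ℝ) else 0) *
            (Real.sqrt X * Real.sqrt e / e) := mul_le_mul_of_nonneg_left hkey hk0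
      _ = Real.sqrt X * (f e / e) := by simp only [hf]; ring
  calc ∑ e ∈ Icc 1 X, (if Squarefree e then ∏ p ∈ e.primeFactors, 12 / (p : ℝ) else 0)
      ≤ ∑ e ∈ Icc 1 X, Real.sqrt X * (f e / e) := sum_le_sum hpt
    _ = Real.sqrt X * ∑ e ∈ Icc 1 X, f e / e := by rw [mul_sum]
    _ ≤ Real.sqrt X * Real.exp (4 * 12) := mul_le_mul_of_nonneg_left hmean (Real.sqrt_nonneg _)
    _ = Real.exp 48 * Real.sqrt X := by norm_num; ring

/-! ### Part 3. Short sums of `Λc` -/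

/-- `Σ_{e≤Z} h(e)/e ≤ e^{12+6S₀}` for EVERY `Z` (the tree's `sum_sqfreeKernel_div_le` for `Z ≥ 2`;
`Z ≤ 1` by hand). [cite: Zhang2022LandauSiegel, §7 p.33] -/
private theorem sum_sqfreeKernel_div_le_all (Z : ℕ) :
    ∑ e ∈ Icc 1 Z, (if Squarefree e then ∏ p ∈ e.primeFactors, 12 / (p : ℝ) else 0) / e ≤
      Real.exp (12 + 6 * LogEulerProduct.tailConst 0) := by
  rcases Nat.lt_or_ge Z 2 with hZ2 | hZ2
  · have hE1 : (1 : ℝ) ≤ Real.exp (12 + 6 * LogEulerProduct.tailConst 0) :=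
      Real.one_le_exp (by linarith [LogEulerProduct.tailConst_nonneg 0])
    interval_cases Z
    · simp; linarith
    · rw [show Icc 1 1 = {1} by rfl, sum_singleton]
      simp; linarith [LogEulerProduct.tailConst_nonneg 0]
  · exact sum_sqfreeKernel_div_le hZ2

/-- The multiples of `e ≥ 1` among the integers `d ≤ K` of a real interval `(u, u+v]` (`u, v ≥ 0`)
number at most `v/e + 1`. [folklore] -/
private theorem card_multiples_Ioc_le (K : ℕ) {e : ℕ} (he : 0 < e) {u v : ℝ} (hu : 0 ≤ u)
    (hv : 0 ≤ v) :
    ((((Icc 1 K).filter (fun d : ℕ => u < (d : ℝ) ∧ (d : ℝ) ≤ u + v)).filter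
        (fun d => e ∣ d)).card : ℝ) ≤ v / e + 1 := by
  have he0 : (0 : ℝ) < e := by exact_mod_cast he
  set S := ((Icc 1 K).filter (fun d : ℕ => u < (d : ℝ) ∧ (d : ℝ) ≤ u + v)).filter
    (fun d => e ∣ d) with hS
  -- `d ↦ d / e` maps `S` injectively into the integers of `(u/e, (u+v)/e]`
  have hmaps : ∀ d ∈ S, d / e ∈ Finset.Ioc ⌊u / e⌋₊ ⌊(u + v) / e⌋₊ := by
    intro d hd
    rw [hS, mem_filter, mem_filter] at hd
    obtain ⟨⟨-, hud, hduv⟩, ⟨m, rfl⟩⟩ := hd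
    rw [Nat.mul_div_cancel_left m he, Finset.mem_Ioc]
    push_cast at hud hduv
    constructor
    · refine (Nat.floor_lt (div_nonneg hu he0.le)).mpr ?_
      rw [div_lt_iff₀ he0]; linarith
    · refine Nat.le_floor ?_
      rw [le_div_iff₀ he0]; linarith
  have hinj : Set.InjOn (fun d => d / e) (S : Set ℕ) := by
    intro d₁ hd₁ d₂ hd₂ h
    rw [mem_coe, hS, mem_filter] at hd₁ hd₂
    obtain ⟨m₁, rfl⟩ := hd₁.2
    obtain ⟨m₂, rfl⟩ := hd₂.2
    simp only [Nat.mul_div_cancel_left _ he] at h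
    rw [h]
  have hcard := Finset.card_le_card_of_injOn (fun d => d / e) hmaps hinj
  rw [Nat.card_Ioc] at hcard
  have h1 : (S.card : ℝ) ≤ ((⌊(u + v) / e⌋₊ - ⌊u / e⌋₊ : ℕ) : ℝ) := by exact_mod_cast hcard
  have hfl : ⌊u / e⌋₊ ≤ ⌊(u + v) / e⌋₊ :=
    Nat.floor_le_floor (div_le_div_of_nonneg_right (by linarith) he0.le)
  rw [Nat.cast_sub hfl] at h1
  have hb : (⌊(u + v) / e⌋₊ : ℝ) ≤ (u + v) / e := Nat.floor_le (by positivity)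
  have ha : u / e < (⌊u / e⌋₊ : ℝ) + 1 := Nat.lt_floor_add_one _
  have : (u + v) / e - u / e = v / e := by ring
  linarith

/-- **Short sums of `Λc`**: for reals `u, v ≥ 0` and every `K`,
`Σ_{u<d≤u+v, d≤K} Λc(d) ≤ e^{12+6S₀}·v + e^{48}√(u+v)·1 + e^{48}·√(u+v)` — precisely
`≤ E₀·v + 2e^{48}√(u+v) + 1`... stated as `≤ E₀ v + e^{48}√(u+v) + e^{48}√(u+v)` with
`E₀ = exp(12+6S₀)`: `Λc = ζ ∗ h`, the multiples of `e` in `(u,u+v]` number `≤ v/e + 1`, and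
`Σ_e h(e)/e ≤ E₀` (`sum_sqfreeKernel_div_le`), `Σ_{e≤u+v} h(e) ≤ e^{48}√(u+v)`.
[cite: Zhang2022LandauSiegel, §7 p.33; §12 p.67] -/
theorem sum_LamC_short_le (K : ℕ) {u v : ℝ} (hu : 0 ≤ u) (hv : 0 ≤ v) :
    ∑ d ∈ (Icc 1 K).filter (fun d : ℕ => u < (d : ℝ) ∧ (d : ℝ) ≤ u + v), LamC d ≤
      Real.exp (12 + 6 * LogEulerProduct.tailConst 0) * v + Real.exp 48 * Real.sqrt (u + v) := by
  set S := (Icc 1 K).filter (fun d : ℕ => u < (d : ℝ) ∧ (d : ℝ) ≤ u + v) with hS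
  set Z : ℕ := ⌊u + v⌋₊ with hZ
  set h : ℕ → ℝ := fun k => if Squarefree k then ∏ p ∈ k.primeFactors, 12 / (p : ℝ) else 0
    with hh
  have hh0 : ∀ k, 0 ≤ h k := fun k => sqfreeKernel_nonneg k
  -- Step 1: `Σ_{d∈S} Λc(d) = Σ_{e ≤ Z} h(e)·#{d ∈ S : e ∣ d}`
  have hstep1 : ∑ d ∈ S, LamC d = ∑ e ∈ Icc 1 Z, h e * ((S.filter (fun d => e ∣ d)).card : ℝ) := by
    calc ∑ d ∈ S, LamC d = ∑ d ∈ S, ∑ e ∈ d.divisors, h e := by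
          refine sum_congr rfl fun d _ => ?_
          rw [LamC_eq_sum_divisors_sqfreeKernel]
      _ = ∑ e ∈ Icc 1 Z, ∑ d ∈ S.filter (fun d => e ∣ d), h e := by
          rw [sum_comm' (t' := Icc 1 Z) (s' := fun e => S.filter (fun d => e ∣ d))]
          intro d e
          simp only [hS, mem_filter, Nat.mem_divisors, mem_Icc]
          constructor
          · rintro ⟨⟨⟨hd1, hdK⟩, hud, hduv⟩, hed, hd0⟩
            have he0 : 0 < e := Nat.pos_of_dvd_of_pos hed (by omega)
            have hed' : e ≤ d := Nat.le_of_dvd (by omega) hed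
            refine ⟨⟨⟨⟨hd1, hdK⟩, hud, hduv⟩, hed⟩, he0, ?_⟩
            rw [hZ, Nat.le_floor_iff (by linarith)]
            exact le_trans (by exact_mod_cast hed') hduv
          · rintro ⟨⟨⟨⟨hd1, hdK⟩, hud, hduv⟩, hed⟩, he1, -⟩
            exact ⟨⟨⟨hd1, hdK⟩, hud, hduv⟩, hed, by omega⟩
      _ = ∑ e ∈ Icc 1 Z, h e * ((S.filter (fun d => e ∣ d)).card : ℝ) := by
          refine sum_congr rfl fun e _ => ?_
          rw [sum_const, nsmul_eq_mul, mul_comm]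
  -- Step 2: the count and the two means of `h`
  have hZle : (Z : ℝ) ≤ u + v := Nat.floor_le (by linarith)
  calc ∑ d ∈ S, LamC d = ∑ e ∈ Icc 1 Z, h e * ((S.filter (fun d => e ∣ d)).card : ℝ) := hstep1
    _ ≤ ∑ e ∈ Icc 1 Z, h e * (v / e + 1) := by
        refine sum_le_sum fun e he => mul_le_mul_of_nonneg_left ?_ (hh0 e)
        exact card_multiples_Ioc_le K (mem_Icc.mp he).1 hu hv
    _ = v * ∑ e ∈ Icc 1 Z, h e / e + ∑ e ∈ Icc 1 Z, h e := by
        rw [mul_sum, ← sum_add_distrib]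
        exact sum_congr rfl fun e _ => by ring
    _ ≤ v * Real.exp (12 + 6 * LogEulerProduct.tailConst 0) + Real.exp 48 * Real.sqrt Z := by
        exact add_le_add (mul_le_mul_of_nonneg_left (sum_sqfreeKernel_div_le_all Z) hv)
          (sum_sqfreeKernel_le_sqrt Z)
    _ ≤ Real.exp (12 + 6 * LogEulerProduct.tailConst 0) * v + Real.exp 48 * Real.sqrt (u + v) := by
        rw [mul_comm v]
        gcongr

/-! ### Part 4. The convergent `r`-weights `ρ(r) = Λc(r)2^{ω(r)}/φ(r)` -/

/-- **`Σ_{r≤X} Λc(r)2^{ω(r)}/(φ(r)√r) ≤ e^{112}`** for every `X`: the function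
`r ↦ Λc(r)2^{ω(r)}·r/(φ(r)√r)` is multiplicative with `f(p^ν)/p^ν = 2(1+12/p)(p/(p−1))p^{−3ν/2}
≤ (28/(p√p))·2^{1−ν}`, so `sum_div_le_exp_of_decay` applies with `c = 28`.
[cite: Zhang2022LandauSiegel, §7 Prop. 7.1 p.33] -/
theorem sum_rho_div_sqrt_le (X : ℕ) :
    ∑ r ∈ Icc 1 X, LamC r * (2 : ℝ) ^ r.primeFactors.card / ((Nat.totient r : ℝ) * Real.sqrt r) ≤
      Real.exp 112 := by
  set f : ℕ → ℝ := fun r =>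
    LamC r * (2 : ℝ) ^ r.primeFactors.card * (r : ℝ) / ((Nat.totient r : ℝ) * Real.sqrt r) with hf
  have hf0 : ∀ r, 0 ≤ f r := fun r => by
    simp only [hf]; exact div_nonneg (by have := LamC_nonneg r; positivity) (by positivity)
  have hf1 : f 1 = 1 := by simp [hf, isMultiplicative_LamC.map_one]
  have hmul : ∀ m n, Nat.Coprime m n → f (m * n) = f m * f n := by
    intro m n hmn
    rcases Nat.eq_zero_or_pos m with rfl | hm
    · simp only [Nat.coprime_zero_left] at hmn; subst hmn; simp [hf]
    rcases Nat.eq_zero_or_pos n with rfl | hn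
    · simp only [Nat.coprime_zero_right] at hmn; subst hmn; simp [hf]
    simp only [hf]
    rw [isMultiplicative_LamC.map_mul_of_coprime hmn, Nat.primeFactors_mul hm.ne' hn.ne',
      card_union_of_disjoint hmn.disjoint_primeFactors, pow_add, Nat.totient_mul hmn,
      Nat.cast_mul, Nat.cast_mul, Real.sqrt_mul (Nat.cast_nonneg m)]
    have hφm : (0 : ℝ) < Nat.totient m := by exact_mod_cast Nat.totient_pos.mpr hm
    have hφn : (0 : ℝ) < Nat.totient n := by exact_mod_cast Nat.totient_pos.mpr hn
    have hsm : 0 < Real.sqrt (m : ℝ) := Real.sqrt_pos.mpr (by exact_mod_cast hm)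
    have hsn : 0 < Real.sqrt (n : ℝ) := Real.sqrt_pos.mpr (by exact_mod_cast hn)
    field_simp
  have hdec : ∀ p ν : ℕ, p.Prime → 1 ≤ ν →
      f (p ^ ν) / (p : ℝ) ^ ν ≤ 28 / ((p : ℝ) * Real.sqrt p) * (1 / 2 : ℝ) ^ (ν - 1) := by
    intro p ν hp hν
    have hp2 : (2 : ℝ) ≤ p := by exact_mod_cast hp.two_le
    have hp0 : (0 : ℝ) < p := by linarith
    have hsp : 0 < Real.sqrt (p : ℝ) := Real.sqrt_pos.mpr hp0
    have hsq : Real.sqrt (p : ℝ) * Real.sqrt p = p := Real.mul_self_sqrt hp0.le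
    obtain ⟨k, rfl⟩ : ∃ k, ν = k + 1 := ⟨ν - 1, by omega⟩
    simp only [hf, Nat.add_sub_cancel]
    rw [Nat.primeFactors_prime_pow (by omega) hp, card_singleton, pow_one,
      Nat.totient_prime_pow hp (by omega), Nat.add_sub_cancel, Nat.cast_mul, Nat.cast_pow,
      Nat.cast_sub hp.one_le, Nat.cast_one, Nat.cast_pow]
    -- `Λc(p^{k+1}) = 1 + 12/p ≤ 7`
    have hL : LamC (p ^ (k + 1)) ≤ 7 := LamC_prime_pow_le hp (k + 1)
    have hL0 : 0 ≤ LamC (p ^ (k + 1)) := LamC_nonneg _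
    -- `√(p^{k+1}) = √p · p^... `: use `(p^{k+1} : ℝ) = p^k * p`
    have hpk : (0 : ℝ) < (p : ℝ) ^ k := by positivity
    have hsqrt_pow : Real.sqrt ((p : ℝ) ^ (k + 1)) = Real.sqrt ((p : ℝ) ^ k) * Real.sqrt p := by
      rw [pow_succ, Real.sqrt_mul (by positivity)]
    rw [hsqrt_pow]
    have hsk : 0 < Real.sqrt ((p : ℝ) ^ k) := Real.sqrt_pos.mpr hpk
    have hsk2 : Real.sqrt ((p : ℝ) ^ k) * Real.sqrt ((p : ℝ) ^ k) = (p : ℝ) ^ k :=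
      Real.mul_self_sqrt hpk.le
    -- the key numeric facts: `(1/2)^k ≥ 1/ (√(p^k))` is false in general; instead use
    -- `p^k ≥ 2^k`, i.e. `1/p^k ≤ (1/2)^k`, and `1/√(p^k) ≤ 1`.
    have hhalf : (1 : ℝ) / (p : ℝ) ^ k ≤ (1 / 2 : ℝ) ^ k := by
      rw [one_div, ← inv_pow, one_div]
      exact pow_le_pow_left₀ (by positivity) (by
        rw [inv_le_inv₀ hp0 (by norm_num)]; exact hp2) k
    have hsk1 : 1 ≤ Real.sqrt ((p : ℝ) ^ k) := by
      rw [show (1 : ℝ) = Real.sqrt 1 by simp]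
      exact Real.sqrt_le_sqrt (one_le_pow₀ (by linarith))
    have hpm1 : (1 : ℝ) ≤ (p : ℝ) - 1 := by linarith
    -- LHS = Λc·2·p^{k+1} / ((p^{k+1} − p^k)·√(p^k)√p·p^{k+1})
    --     = 2Λc / ((p − 1) p^k √(p^k) √p)
    have e1 : LamC (p ^ (k + 1)) * 2 * ((p : ℝ) ^ (k + 1)) /
          ((p : ℝ) ^ k * ((p : ℝ) - 1) * (Real.sqrt ((p : ℝ) ^ k) * Real.sqrt p)) /
          (p : ℝ) ^ (k + 1) =
        2 * LamC (p ^ (k + 1)) / (((p : ℝ) - 1) * Real.sqrt p) *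
          (1 / (p : ℝ) ^ k) * (1 / Real.sqrt ((p : ℝ) ^ k)) := by
      field_simp
    rw [e1]
    have hA : 2 * LamC (p ^ (k + 1)) / (((p : ℝ) - 1) * Real.sqrt p) ≤
        28 / ((p : ℝ) * Real.sqrt p) := by
      rw [div_le_div_iff₀ (by positivity) (by positivity)]
      -- `2Λc·p√p ≤ 28 (p−1)√p` since `Λc ≤ 7` and `p ≤ 2(p−1)`
      have : (p : ℝ) ≤ 2 * ((p : ℝ) - 1) := by linarith
      nlinarith [mul_nonneg hL0 hsp.le, mul_le_mul_of_nonneg_right hL hsp.le,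
        mul_le_mul_of_nonneg_right this hsp.le]
    calc 2 * LamC (p ^ (k + 1)) / (((p : ℝ) - 1) * Real.sqrt p) * (1 / (p : ℝ) ^ k) *
          (1 / Real.sqrt ((p : ℝ) ^ k))
        ≤ 28 / ((p : ℝ) * Real.sqrt p) * (1 / 2 : ℝ) ^ k * 1 := by
          refine mul_le_mul (mul_le_mul hA hhalf (by positivity) (by positivity)) ?_
            (by positivity) (by positivity)
          rw [div_le_one hsk]; exact hsk1
      _ = 28 / ((p : ℝ) * Real.sqrt p) * (1 / 2 : ℝ) ^ k := mul_one _
  have hmean := sum_div_le_exp_of_decay hf1 hmul hf0 (by norm_num : (0 : ℝ) ≤ 28) hdec X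
  have hpt : ∀ r ∈ Icc 1 X, LamC r * (2 : ℝ) ^ r.primeFactors.card /
      ((Nat.totient r : ℝ) * Real.sqrt r) = f r / r := by
    intro r hr
    have hr0 : (0 : ℝ) < r := by exact_mod_cast (mem_Icc.mp hr).1
    simp only [hf]
    field_simp
  calc ∑ r ∈ Icc 1 X, LamC r * (2 : ℝ) ^ r.primeFactors.card / ((Nat.totient r : ℝ) * Real.sqrt r)
      = ∑ r ∈ Icc 1 X, f r / r := sum_congr rfl hpt
    _ ≤ Real.exp (4 * 28) := hmean
    _ = Real.exp 112 := by norm_num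

/-- **`Σ_{r≤X} Λc(r)2^{ω(r)}/(φ(r)·r) ≤ e^{112}`** (termwise `≤` the previous sum, `√r ≤ r`).
[cite: Zhang2022LandauSiegel, §7 Prop. 7.1 p.33] -/
theorem sum_rho_div_le (X : ℕ) :
    ∑ r ∈ Icc 1 X, LamC r * (2 : ℝ) ^ r.primeFactors.card / ((Nat.totient r : ℝ) * r) ≤
      Real.exp 112 := by
  refine le_trans (sum_le_sum fun r hr => ?_) (sum_rho_div_sqrt_le X)
  have hr1 : (1 : ℝ) ≤ r := by exact_mod_cast (mem_Icc.mp hr).1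
  have hr0 : (0 : ℝ) < r := by linarith
  have hφ : (0 : ℝ) < Nat.totient r := by
    exact_mod_cast Nat.totient_pos.mpr (mem_Icc.mp hr).1
  have hsr : Real.sqrt (r : ℝ) ≤ r := by
    rw [Real.sqrt_le_iff]; exact ⟨hr0.le, by nlinarith⟩
  exact div_le_div_of_nonneg_left (by have := LamC_nonneg r; positivity) (by positivity)
    (mul_le_mul_of_nonneg_left hsr hφ.le)

end Literature.NumberTheory.LFunctions.Zhang2022.XiZeroMajorant
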